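import Literature.AnabelianGeometry.EtaleTheta.Discharge.Sec5OfQuotientTemperoidData

/-!
# [EtTh] §5 data over `B^temp(G)⁰` from an ARBITRARY root datum — the common core of the «JUNCTION TWIN» (§5 pp.330–331 / PDF pp.104–105)

S. Mochizuki, *The étale theta function and its Frobenioid-theoretic manifestations*, Publ. RIMS **45** (2009) [MochizukiEtTh2009],
§5 pp.330–331 (PDF pp.104–105): "we obtain a pair of base-equivalent pre-steps `s^⊓_N, s^⊔_N : A_N → B_N`", "the natural
[surjective] outer homomorphism `Π^tp_X ↠ Aut_D(B_N^bs)`", "the group homomorphism `s^trv_N : Aut_D(A_N^bs) → Aut_C(A_N)` arising from a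
base-Frobenius pair of `A_N`"; Prop. 5.2 (i) p.324 (PDF p.98); Rmk. 4.3.2 p.318 (PDF p.92) [cite: MochizukiEtTh2009, §5 p.330–331 (PDF pp.104–105)].

abc-iut cell, layer L2 [EtTh]; seat abc-iut-L2-t3 (gen 10), row «JUNCTION TWIN» (abc-iut-L2-lead R1374), COMMON CORE of both keyed forms
(FINDING F-L2t3g10-3 «TWIN-FACTS»).  The frozen constructor `ThetaFrobenioid.ofQuotientTemperoidData` (abc-iut-L2-t3, p497260) types its
root datum as the NESTED binder `(R : S.NthRoot Rl.root Rl.pair N)` of an `l`-th root `Rl` in the SAME `A_⊙`-anchored setting `S` — a shape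
whose `fixed` clause is not inhabited at the small-index instance (abc-iut-L2-t3 memo N-P42III-DOMAIN, adopted R1374).  Underneath,
abc-iut-L2-t4's `ofBiKummerData` / `ofRootData` consume from `R` ONLY `(A_N, B_N, s^⊓_N, s^⊔_N)`, the Galois datum of `A_N^bs` and the
Frobenius-triviality of `A_N` — never the saturation clause.  This file therefore provides the constructor ONCE over an ARBITRARY root
datum `R : S.NthRoot f P M` of the quotient-temperoid setting (`f` a birational function on ANY object, `M` any order), with the theta
function `θ` on a displayed carrier `A_⊚` (for the twins: the original anchor `A_⊙`), the prime `l` and the §2 datum `T : ThetaEnvData N`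
displayed independently of the setting that types `R`:
* **`ofQuotientTemperoidRootData`** — `ofRootData` over `sec5Stub`, `A_⊚ := Acirc`, `Θ := θ`, `(A_N, B_N, s^⊓_N, s^⊔_N) :=` those of `R`,
  `ρ :=` the setting's `Π^tp_X ↠ Aut_D(A_N^bs)` transported along `(s^⊓_N)^bs` (`rhoOfRoot`), `s^trv_N :=` the [FrdI] Prop. 5.6 section of
  the Frobenius-trivial `A_N` (`strvOfRoot`), `hdivc`/`hdivp` from the divisor invariances `hinvc`/`hinvp` (as in the frozen file).  Its TYPE is
  LITERALLY that of the frozen constructor: `ThetaFrobenioid.{w} (BiKummerSetting.mkOfQuotientTemperoid X hG φ hφ tf hZ hP NH A₀ hA₀ hA₀').C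
  (ConnectedPart (BTemp G))`.
* rfl dictionary `ofQuotientTemperoidRootData_pre/_strv/_PiX`, and the five portable laws `strvSection_`, `sgpCapSpec_`, `sgpCupSpec_`,
  `sgpCapSection_`, `autAmpleBN_ofQuotientTemperoidRootData` (all UNCONDITIONAL), plus `facts_ofQuotientTemperoidRootData` from the TWO
  printed facts `BiKummerDifferenceMem` (Prop. 4.3 (iii)) and `ConstantsActByCyclotome` (Lemma 5.8) DISPLAYED — honest: Prop. 4.3 (iii) for
  a root datum is proved in the tree (`Discharge/Sec5OfBiKummerDataKummer`) only through the anchored clauses `Π^tp_Ÿ ⊆ H_⊙` and `fixed`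
  of the setting that types the root (F-L2t3g10-3), so it is NOT discharged at this generality.
* `ofQuotientTemperoidData_eq_ofQuotientTemperoidRootData` — the frozen constructor IS the core at the nested root (`rfl`).
HONEST FRAMING: a constructor and kernel-checked consequences for data so constructed over abc-iut-L2-t3's quotient-temperoid setting;
[EtTh]/[FrdI] are refereed prerequisite papers; nothing here bears on, or takes a side on, the disputed [IUTchIII] Cor. 3.12; nothing here
asserts abc proved or refuted.
-/

noncomputable section

namespace Literature.AnabelianGeometry.EtaleTheta

open CategoryTheory Opposite Literature.AlgebraicGeometry.Frobenioids Literature.AnabelianGeometry.SemiGraphs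
  Literature.AnabelianGeometry.SemiGraphs.GaloisObjects

universe u₀ v₀ u v w

namespace ThetaFrobenioid

section Generic

variable {K : Type u₀} [Field K] {X : SemiGraphs.TemperedArithmeticGroup.{u₀} K} {D₀ : Type u₀} [Category.{v₀} D₀]
  {V : FrdIMonoidStub.{w}} {T₀ : RealifiedDivisorMonoids (D₀ := D₀) V} {D : Type u} [Category.{v} D]
  {VD : FrdICatStub.{u, v, w} D} {S : BiKummerSetting X T₀ D VD}
  {pullFrac : ∀ {A A' : S.C} (_ : A' ⟶ A), S.biratUnits A → S.biratUnits A'}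
  {N M : ℕ+} {T : ThetaEnvData.{max v w} N} {Af Bf : S.C} {f : S.biratUnits Af} {P : S.FractionPair f Bf}
  (h : ModelFrobenioid.Hypotheses S.tf.divisorMonoid S.tf.ratFnFunctor) (R : S.NthRoot f P M pullFrac) (ιX : T.PiX ≃ₜ* X.Pi)

/-- **`Π^tp_X ↠ Aut_D(B_N^bs)` for an arbitrary root datum** ("the natural [surjective] outer homomorphism `Π^tp_X ↠ Aut_D(B_N^bs)` [cf.
Definition 4.1, (ii)]", p.331 (PDF p.105)): the setting's `Π^tp_X ↠ Aut_D(A_N^bs)` at the Galois object `A_N^bs` transported along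
`(s^⊓_N)^bs : A_N^bs ⥲ B_N^bs`, precomposed with `ιX` (verbatim abc-iut-L2-t4's `rhoOfBiKummerData`, root binder generalised from the
nested `S.NthRoot Rl.root Rl.pair N` to any `S.NthRoot f P M`).  [cite: MochizukiEtTh2009, §5 p.331 (PDF p.105); Def 4.1 (ii) p.313 (PDF p.87)] -/
def rhoOfRoot : T.PiX →* Aut R.BN.base :=
  (BiKummerSetting.NthRoot.baseIso S R).conjAut.toMonoidHom.comp
    ((S.galoisSurj R.AN.base R.αData.isGalois).comp ιX.toMulEquiv.toMonoidHom)

/-- `ρ(y) = (s^⊓_N)^bs ∘ ρ_{A_N}(ιX y) ∘ ((s^⊓_N)^bs)⁻¹`. [cite: MochizukiEtTh2009, §5 p.331 (PDF p.105)] -/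
theorem rhoOfRoot_apply (y : T.PiX) :
    rhoOfRoot R ιX y = (BiKummerSetting.NthRoot.baseIso S R).conjAut (S.galoisSurj R.AN.base R.αData.isGalois (ιX y)) :=
  rfl

/-- `Π^tp_X ↠ Aut_D(B_N^bs)` is surjective (Def. 4.1 (ii), p.313 (PDF p.87)). [cite: MochizukiEtTh2009, Def 4.1 (ii) p.313 (PDF p.87)] -/
theorem rhoOfRoot_surjective : Function.Surjective (rhoOfRoot R ιX) :=
  (BiKummerSetting.NthRoot.baseIso S R).conjAut.surjective.comp
    ((S.galoisSurj_surjective R.AN.base R.αData.isGalois).comp ιX.toMulEquiv.surjective)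

/-- `Ker(Π^tp_X ↠ Aut_D(B_N^bs))` is open when `Ker(Π^tp_X ↠ Aut_D(A_N^bs))` is (input `hopen`; discharged over `B^temp(G)⁰` below).
[cite: MochizukiEtTh2009, §4 p.312 (PDF p.86)] -/
theorem isOpen_ker_rhoOfRoot (hopen : IsOpen ((S.galoisSurj R.AN.base R.αData.isGalois).ker : Set X.Pi)) :
    IsOpen ((rhoOfRoot R ιX).ker : Set T.PiX) := by
  have hker : ((rhoOfRoot R ιX).ker : Set T.PiX) = ιX ⁻¹' ((S.galoisSurj R.AN.base R.αData.isGalois).ker : Set X.Pi) := by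
    ext y
    rw [SetLike.mem_coe, MonoidHom.mem_ker, Set.mem_preimage, SetLike.mem_coe, MonoidHom.mem_ker, rhoOfRoot_apply,
      MulEquiv.map_eq_one_iff]
  rw [hker]
  exact hopen.preimage ιX.continuous

/-- **`s^trv_N` for an arbitrary root datum** (p.330–331 (PDF pp.104–105)): the [FrdI] Prop. 5.6 section of the Frobenius-trivial
`N`-domain `A_N` (Def. 4.1 (iv)(a), `R.αData.isFrobeniusTrivial`) — verbatim `strvOfBiKummerData`, root binder generalised.
[cite: MochizukiEtTh2009, §5 p.330–331 (PDF pp.104–105)] -/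
def strvOfRoot : Aut R.AN.base →* Aut R.AN :=
  ModelFrobenioid.frobTrivSection h R.AN R.αData.isFrobeniusTrivial

/-- `strvOfRoot` is a section: `Base(s^trv_N(g)) = g`. [cite: MochizukiEtTh2009, §5 p.331 (PDF p.105)] -/
theorem baseMap_strvOfRoot (g : Aut R.AN.base) : ModelFrobenioid.baseMap (strvOfRoot h R g).hom = g.hom :=
  ModelFrobenioid.baseMap_frobTrivSection h R.AN R.αData.isFrobeniusTrivial g

/-- **`hdivc` from divisor invariance, arbitrary root datum** (p.330 (PDF p.104): `Div(s^⊓_N)` descends to `Φ(A_⊙)`, so it is fixed by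
every `g ∈ Aut_D(A_N^bs)`): for any section `σ` of `A_N`, `Div(σ(g') ∘ s^⊓_N) = Div s^⊓_N` as soon as `Φ(g)(Div s^⊓_N) = Div s^⊓_N` for all
`g` (verbatim `hdivc_of_pull_invariant`, root binder generalised).  [cite: MochizukiEtTh2009, §5 p.330 (PDF p.104)] -/
theorem hdivc_of_pull_invariant_root (hΦd : Objectwise (fun M _ => IsDivisorial M) S.tf.divisorMonoid)
    (σ : Aut R.AN.base →* Aut R.AN) (hσ : ∀ g : Aut R.AN.base, ModelFrobenioid.baseMap (σ g).hom = g.hom)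
    (hinv : ∀ g : Aut R.AN.base, pull S.tf.divisorMonoid g.hom (ModelFrobenioid.div R.pair.num) = ModelFrobenioid.div R.pair.num)
    (g : Aut R.BN.base) :
    ModelFrobenioid.div ((σ ((BiKummerSetting.NthRoot.baseIso S R).conjAut.symm g)).hom ≫ R.pair.num) =
      ModelFrobenioid.div R.pair.num := by
  rw [ModelFrobenioid.div_comp_of_isIso' hΦd, hσ]
  exact hinv _

/-- **`hdivp` from divisor invariance, arbitrary root datum** (Prop. 4.3 (i) proof, p.317 (PDF p.91): "it suffices to prove that `Div(s'_N)`,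
`Div(s''_N) ∈ Φ(A_N)` are fixed by `H_{A_N}`"): for any section `σ`, `Div(σ(ρ_{A_N}(y)) ∘ s^⊔_N) = Div s^⊔_N` for `y ∈ Π^tp_Ÿ` as soon as
`Φ(ρ_{A_N}(y))(Div s^⊔_N) = Div s^⊔_N` (verbatim `hdivp_of_pull_invariant`, root binder generalised).
[cite: MochizukiEtTh2009, Prop 4.3 (i) p.317 (PDF p.91); §5 p.331 (PDF p.105)] -/
theorem hdivp_of_pull_invariant_root (hΦd : Objectwise (fun M _ => IsDivisorial M) S.tf.divisorMonoid)
    (σ : Aut R.AN.base →* Aut R.AN) (hσ : ∀ g : Aut R.AN.base, ModelFrobenioid.baseMap (σ g).hom = g.hom)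
    (hinv : ∀ y : T.PiX, y ∈ T.PiYdd →
      pull S.tf.divisorMonoid (S.galoisSurj R.AN.base R.αData.isGalois (ιX y)).hom (ModelFrobenioid.div R.pair.den) =
        ModelFrobenioid.div R.pair.den)
    (y : T.PiYdd) :
    ModelFrobenioid.div ((σ (S.galoisSurj R.AN.base R.αData.isGalois (ιX y.1))).hom ≫ R.pair.den) =
      ModelFrobenioid.div R.pair.den := by
  rw [ModelFrobenioid.div_comp_of_isIso' hΦd, hσ]
  exact hinv y.1 y.2

end Generic

section RootData

variable {K : Type u₀} [Field K] {X : SemiGraphs.TemperedArithmeticGroup.{u₀} K}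
  {G : Type u} [Group G] [TopologicalSpace G] [IsTopologicalGroup G] {hG : IsTempered G}
  {φ : X.Pi →ₜ* G} {hφ : Function.Surjective φ}
  {D₀ : Type u₀} [Category.{v₀} D₀] {V : FrdIMonoidStub.{w}} {T₀ : RealifiedDivisorMonoids (D₀ := D₀) V}
  {VD : FrdICatStub.{u + 1, u, w} (ConnectedPart (BTemp G))}
  {tf : TemperedFrobenioid T₀ (ConnectedPart (BTemp G)) VD} {hZ : tf.monoidType = MonoidType.Z}
  {hP : ∀ A : (ConnectedPart (BTemp G))ᵒᵖ, IsPerfect (tf.Φ.carrier A)}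
  {NH : Subgroup (Field.absoluteGaloisGroup K) → tf.category → ℕ+ → Prop} {A₀ : tf.category}
  {hA₀ : PreFrobenioid.IsFrobeniusTrivial tf.toElem A₀} {hA₀' : SemiGraphs.IsGaloisObj A₀.base.obj}
  {pullFrac : ∀ {A A' : (BiKummerSetting.mkOfQuotientTemperoid X hG φ hφ tf hZ hP NH A₀ hA₀ hA₀').C} (_ : A' ⟶ A),
    (BiKummerSetting.mkOfQuotientTemperoid X hG φ hφ tf hZ hP NH A₀ hA₀ hA₀').biratUnits A →
      (BiKummerSetting.mkOfQuotientTemperoid X hG φ hφ tf hZ hP NH A₀ hA₀ hA₀').biratUnits A'}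
  {lv N M : ℕ+} {T : ThetaEnvData.{max u w} N}
  {Af Bf : (BiKummerSetting.mkOfQuotientTemperoid X hG φ hφ tf hZ hP NH A₀ hA₀ hA₀').C}
  {f : (BiKummerSetting.mkOfQuotientTemperoid X hG φ hφ tf hZ hP NH A₀ hA₀ hA₀').biratUnits Af}
  {P : (BiKummerSetting.mkOfQuotientTemperoid X hG φ hφ tf hZ hP NH A₀ hA₀ hA₀').FractionPair f Bf}
  {Acirc : (BiKummerSetting.mkOfQuotientTemperoid X hG φ hφ tf hZ hP NH A₀ hA₀ hA₀').C}
  (θ : (BiKummerSetting.mkOfQuotientTemperoid X hG φ hφ tf hZ hP NH A₀ hA₀ hA₀').biratUnits Acirc)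
  (h : ModelFrobenioid.Hypotheses tf.divisorMonoid tf.ratFnFunctor)
  (Q : FrobenioidTheta.ThetaSubquotientStub.{w} (ConnectedPart (BTemp G))) (odd_l : Odd (lv : ℕ))
  (R : (BiKummerSetting.mkOfQuotientTemperoid X hG φ hφ tf hZ hP NH A₀ hA₀ hA₀').NthRoot f P M pullFrac)
  (ιX : T.PiX ≃ₜ* X.Pi) (K' : Type w) [Field K'] (constEmb : K'ˣ →* tf.biratUnitsModel R.BN)
  (constEmb_injective : Function.Injective constEmb)
  (hinvc : ∀ g : Aut R.AN.base,
    pull tf.divisorMonoid g.hom (ModelFrobenioid.div R.pair.num) = ModelFrobenioid.div R.pair.num)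
  (hinvp : ∀ y : T.PiX, y ∈ T.PiYdd →
    pull tf.divisorMonoid ((BiKummerSetting.mkOfQuotientTemperoid X hG φ hφ tf hZ hP NH A₀ hA₀ hA₀').galoisSurj R.AN.base
      R.αData.isGalois (ιX y)).hom (ModelFrobenioid.div R.pair.den) = ModelFrobenioid.div R.pair.den)

/-- **The [EtTh] §5 data over `B^temp(G)⁰` from an ARBITRARY root datum `R`** (§5 pp.330–331 (PDF pp.104–105)): `ofRootData` over
`sec5Stub`, with `A_⊚ := Acirc` (displayed), `Θ := θ`, prime `l`, §2 datum `T`, `(A_N, B_N, s^⊓_N, s^⊔_N) :=` those of `R`, `ρ := rhoOfRoot`,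
`s^trv_N := strvOfRoot`, and `hdivc`/`hdivp` from the divisor invariances `hinvc` (p.330) / `hinvp` (Prop. 4.3 (i) proof p.317).  The
frozen `ofQuotientTemperoidData` is the case `R :=` the nested `N`-th root of an `l`-th root of `θ`
(`ofQuotientTemperoidData_eq_ofQuotientTemperoidRootData`); both keyed twin forms (re-anchored / order `l·N`) are instances.
[cite: MochizukiEtTh2009, §5 p.330–331 (PDF pp.104–105)] -/
def ofQuotientTemperoidRootData :
    ThetaFrobenioid.{w} (BiKummerSetting.mkOfQuotientTemperoid X hG φ hφ tf hZ hP NH A₀ hA₀ hA₀').C (ConnectedPart (BTemp G)) :=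
  ofRootData ((BiKummerSetting.mkOfQuotientTemperoid X hG φ hφ tf hZ hP NH A₀ hA₀ hA₀').sec5Stub h) Q lv odd_l N T Acirc R.AN
    R.BN R.pair.num R.pair.den
    R.pair.base_eq ⟨R.pair.isPreStep_num.1, R.pair.isPreStep_num.2⟩ ⟨R.pair.isPreStep_den.1, R.pair.isPreStep_den.2⟩
    (rhoOfRoot R ιX) (rhoOfRoot_surjective R ιX)
    (isOpen_ker_rhoOfRoot R ιX (BiKummerSetting.mkOfQuotientTemperoid_isOpen_ker_galoisSurj X hG φ hφ tf hZ hP NH A₀ hA₀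
      hA₀' R.AN.base R.αData.isGalois))
    (strvOfRoot h R) K' constEmb
    constEmb_injective θ (epi_of_model (DivB := tf.divBNatTrans) h)
    (ModelFrobenioid.ofModel_isOfIsotropicType tf.divisorMonoid tf.ratFnFunctor tf.divBNatTrans h.isGroupLike_rat)
    (iiid_sec5Stub h)
    (fun g => hdivc_of_pull_invariant_root R h.isDivisorial (strvOfRoot h R) (baseMap_strvOfRoot h R) hinvc g)
    (by
      rintro ⟨_, y, hy, rfl⟩
      change ((BiKummerSetting.mkOfQuotientTemperoid X hG φ hφ tf hZ hP NH A₀ hA₀ hA₀').sec5Stub h).pre.div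
        ((strvOfRoot h R ((BiKummerSetting.NthRoot.baseIso _ R).conjAut.symm
          ((BiKummerSetting.NthRoot.baseIso _ R).conjAut
            ((BiKummerSetting.mkOfQuotientTemperoid X hG φ hφ tf hZ hP NH A₀ hA₀ hA₀').galoisSurj R.AN.base R.αData.isGalois
              (ιX y))))).hom ≫ R.pair.den) = _
      rw [MulEquiv.symm_apply_apply]
      exact hdivp_of_pull_invariant_root R ιX h.isDivisorial (strvOfRoot h R) (baseMap_strvOfRoot h R) hinvp ⟨y, hy⟩)

/-- The operations of the data are the model's `(Base, Div, deg_Fr)` ([FrdI] Thm. 5.2 (i)) — every "model case" discharge applies with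
`h𝔉 := rfl`. [cite: MochizukiFrdI2008, Thm. 5.2 (i) p.100] -/
theorem ofQuotientTemperoidRootData_pre :
    (ofQuotientTemperoidRootData θ h Q odd_l R ιX K' constEmb constEmb_injective hinvc hinvp).pre =
      PreFrobenioidData.ofModel tf.divisorMonoid tf.ratFnFunctor tf.divBNatTrans := rfl

/-- `s^trv_N` of the data is the constructed section. [cite: MochizukiEtTh2009, §5 p.331 (PDF p.105)] -/
theorem ofQuotientTemperoidRootData_strv :
    (ofQuotientTemperoidRootData θ h Q odd_l R ιX K' constEmb constEmb_injective hinvc hinvp).strv = strvOfRoot h R := rfl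

/-- The tempered group `Π^tp_X` of the data is that of the §2 datum `T`. [cite: MochizukiEtTh2009, §5 p.331 (PDF p.105)] -/
theorem ofQuotientTemperoidRootData_PiX :
    (ofQuotientTemperoidRootData θ h Q odd_l R ιX K' constEmb constEmb_injective hinvc hinvp).PiX = T.PiX := rfl

/-- `A_⊚` of the data is the displayed carrier `Acirc` of `θ` (for the twins: the ORIGINAL anchor `A_⊙` carrying `Θ̈`, whatever setting
types the root — NOT the domain of `f`). [cite: MochizukiEtTh2009, §5 p.330 (PDF p.104)] -/
theorem ofQuotientTemperoidRootData_Acirc :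
    (ofQuotientTemperoidRootData θ h Q odd_l R ιX K' constEmb constEmb_injective hinvc hinvp).Acirc = Acirc := rfl

/-- `Θ` of the data is the displayed `θ`. [cite: MochizukiEtTh2009, §5 p.330 (PDF p.104)] -/
theorem ofQuotientTemperoidRootData_thetaFn :
    (ofQuotientTemperoidRootData θ h Q odd_l R ιX K' constEmb constEmb_injective hinvc hinvp).thetaFn = θ := rfl

/-- `(A_N, B_N)` of the data are those of the root datum `R`. [cite: MochizukiEtTh2009, §5 p.330 (PDF p.104)] -/
theorem ofQuotientTemperoidRootData_AN_BN :
    (ofQuotientTemperoidRootData θ h Q odd_l R ιX K' constEmb constEmb_injective hinvc hinvp).AN = R.AN ∧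
      (ofQuotientTemperoidRootData θ h Q odd_l R ιX K' constEmb constEmb_injective hinvc hinvp).BN = R.BN := ⟨rfl, rfl⟩

/-- **`StrvSection` is UNCONDITIONAL** (`σ` constructed, [FrdI] Prop. 5.6). [cite: MochizukiEtTh2009, §5 p.331 (PDF p.105)] -/
theorem strvSection_ofQuotientTemperoidRootData :
    (ofQuotientTemperoidRootData θ h Q odd_l R ιX K' constEmb constEmb_injective hinvc hinvp).StrvSection :=
  fun g => Aut.ext (baseMap_strvOfRoot h R g)

/-- `SgpCapSpec` (defining relation of `s^⊓-gp_N`, p.331 (PDF p.105)). [cite: MochizukiEtTh2009, §5 p.331 (PDF p.105)] -/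
theorem sgpCapSpec_ofQuotientTemperoidRootData :
    (ofQuotientTemperoidRootData θ h Q odd_l R ιX K' constEmb constEmb_injective hinvc hinvp).SgpCapSpec := by
  delta ofQuotientTemperoidRootData
  apply sgpCapSpec_ofRootData

/-- `SgpCupSpec` (defining relation of `s^⊔-gp_N`, p.331 (PDF p.105)). [cite: MochizukiEtTh2009, §5 p.331 (PDF p.105)] -/
theorem sgpCupSpec_ofQuotientTemperoidRootData :
    (ofQuotientTemperoidRootData θ h Q odd_l R ιX K' constEmb constEmb_injective hinvc hinvp).SgpCupSpec := by
  delta ofQuotientTemperoidRootData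
  apply sgpCupSpec_ofRootData

/-- `SgpCapSection` (`(s^⊓-gp_N(g))^bs = g`). [cite: MochizukiEtTh2009, §5 p.331 (PDF p.105)] -/
theorem sgpCapSection_ofQuotientTemperoidRootData :
    (ofQuotientTemperoidRootData θ h Q odd_l R ιX K' constEmb constEmb_injective hinvc hinvp).SgpCapSection :=
  sgpCapSection_of _ (sgpCapSpec_ofQuotientTemperoidRootData θ h Q odd_l R ιX K' constEmb constEmb_injective hinvc hinvp)
    (strvSection_ofQuotientTemperoidRootData θ h Q odd_l R ιX K' constEmb constEmb_injective hinvc hinvp)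

/-- `AutAmpleBN` ("it follows that `B_N` is Aut-ample", p.330 (PDF p.104)). [cite: MochizukiEtTh2009, §5 p.330 (PDF p.104)] -/
theorem autAmpleBN_ofQuotientTemperoidRootData :
    (ofQuotientTemperoidRootData θ h Q odd_l R ιX K' constEmb constEmb_injective hinvc hinvp).AutAmpleBN :=
  autAmpleBN_of_sgpCapSection _
    (sgpCapSection_ofQuotientTemperoidRootData θ h Q odd_l R ιX K' constEmb constEmb_injective hinvc hinvp)

/-- **`Facts` for the data from the TWO printed facts `BiKummerDifferenceMem` (Prop. 4.3 (iii)) and `ConstantsActByCyclotome` (Lemma 5.8)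
DISPLAYED** — section property, defining relations, Aut-ampleness, total epimorphicity being THEOREMS.  Honest: Prop. 4.3 (iii) for a
root datum is proved in the tree only through the anchored clauses `Π^tp_Ÿ ⊆ H_⊙` / `fixed` of the setting typing the root
(`Discharge/Sec5OfBiKummerDataKummer`), so it stays an input at this generality.  [cite: MochizukiEtTh2009, §5 p.330–331 (PDF pp.104–105)] -/
theorem facts_ofQuotientTemperoidRootData
    (hdiff : (ofQuotientTemperoidRootData θ h Q odd_l R ιX K' constEmb constEmb_injective hinvc hinvp).BiKummerDifferenceMem)
    (hK : (ofQuotientTemperoidRootData θ h Q odd_l R ιX K' constEmb constEmb_injective hinvc hinvp).ConstantsActByCyclotome) :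
    (ofQuotientTemperoidRootData θ h Q odd_l R ιX K' constEmb constEmb_injective hinvc hinvp).Facts :=
  Facts.of_totallyEpi _ (epi_of_model (DivB := tf.divBNatTrans) h)
    (sgpCapSpec_ofQuotientTemperoidRootData θ h Q odd_l R ιX K' constEmb constEmb_injective hinvc hinvp)
    (sgpCupSpec_ofQuotientTemperoidRootData θ h Q odd_l R ιX K' constEmb constEmb_injective hinvc hinvp)
    (strvSection_ofQuotientTemperoidRootData θ h Q odd_l R ιX K' constEmb constEmb_injective hinvc hinvp) hdiff hK

end RootData

/-! ## The frozen constructor is the core at the nested root -/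

section Nested

variable {K : Type u₀} [Field K] {X : SemiGraphs.TemperedArithmeticGroup.{u₀} K}
  {G : Type u} [Group G] [TopologicalSpace G] [IsTopologicalGroup G] {hG : IsTempered G}
  {φ : X.Pi →ₜ* G} {hφ : Function.Surjective φ}
  {D₀ : Type u₀} [Category.{v₀} D₀] {V : FrdIMonoidStub.{w}} {T₀ : RealifiedDivisorMonoids (D₀ := D₀) V}
  {VD : FrdICatStub.{u + 1, u, w} (ConnectedPart (BTemp G))}
  {tf : TemperedFrobenioid T₀ (ConnectedPart (BTemp G)) VD} {hZ : tf.monoidType = MonoidType.Z}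
  {hP : ∀ A : (ConnectedPart (BTemp G))ᵒᵖ, IsPerfect (tf.Φ.carrier A)}
  {NH : Subgroup (Field.absoluteGaloisGroup K) → tf.category → ℕ+ → Prop} {A₀ : tf.category}
  {hA₀ : PreFrobenioid.IsFrobeniusTrivial tf.toElem A₀} {hA₀' : SemiGraphs.IsGaloisObj A₀.base.obj}
  {pullFrac : ∀ {A A' : (BiKummerSetting.mkOfQuotientTemperoid X hG φ hφ tf hZ hP NH A₀ hA₀ hA₀').C} (_ : A' ⟶ A),
    (BiKummerSetting.mkOfQuotientTemperoid X hG φ hφ tf hZ hP NH A₀ hA₀ hA₀').biratUnits A →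
      (BiKummerSetting.mkOfQuotientTemperoid X hG φ hφ tf hZ hP NH A₀ hA₀ hA₀').biratUnits A'}
  {lv N : ℕ+} {T : ThetaEnvData.{max u w} N}
  {θ : (BiKummerSetting.mkOfQuotientTemperoid X hG φ hφ tf hZ hP NH A₀ hA₀ hA₀').biratUnits
    (BiKummerSetting.mkOfQuotientTemperoid X hG φ hφ tf hZ hP NH A₀ hA₀ hA₀').Aodot}
  {Bl : (BiKummerSetting.mkOfQuotientTemperoid X hG φ hφ tf hZ hP NH A₀ hA₀ hA₀').C}
  {Pl : (BiKummerSetting.mkOfQuotientTemperoid X hG φ hφ tf hZ hP NH A₀ hA₀ hA₀').FractionPair θ Bl}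
  {Rl : (BiKummerSetting.mkOfQuotientTemperoid X hG φ hφ tf hZ hP NH A₀ hA₀ hA₀').NthRoot θ Pl lv pullFrac}
  (h : ModelFrobenioid.Hypotheses tf.divisorMonoid tf.ratFnFunctor)
  (Q : FrobenioidTheta.ThetaSubquotientStub.{w} (ConnectedPart (BTemp G))) (odd_l : Odd (lv : ℕ))
  (R : (BiKummerSetting.mkOfQuotientTemperoid X hG φ hφ tf hZ hP NH A₀ hA₀ hA₀').NthRoot Rl.root Rl.pair N pullFrac)
  (ιX : T.PiX ≃ₜ* X.Pi) (K' : Type w) [Field K'] (constEmb : K'ˣ →* tf.biratUnitsModel R.BN)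
  (constEmb_injective : Function.Injective constEmb)
  (hinvc : ∀ g : Aut R.AN.base,
    pull tf.divisorMonoid g.hom (ModelFrobenioid.div R.pair.num) = ModelFrobenioid.div R.pair.num)
  (hinvp : ∀ y : T.PiX, y ∈ T.PiYdd →
    pull tf.divisorMonoid ((BiKummerSetting.mkOfQuotientTemperoid X hG φ hφ tf hZ hP NH A₀ hA₀ hA₀').galoisSurj R.AN.base
      R.αData.isGalois (ιX y)).hom (ModelFrobenioid.div R.pair.den) = ModelFrobenioid.div R.pair.den)

/-- **The frozen §5 constructor is the common core at the nested root** (definitionally): `ofQuotientTemperoidData h Q odd_l R … =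
ofQuotientTemperoidRootData θ h Q odd_l T R …` — so every theorem about either transfers by `rfl`.
[cite: MochizukiEtTh2009, §5 p.330–331 (PDF pp.104–105)] -/
theorem ofQuotientTemperoidData_eq_ofQuotientTemperoidRootData :
    ofQuotientTemperoidData h Q odd_l R ιX K' constEmb constEmb_injective hinvc hinvp =
      ofQuotientTemperoidRootData θ h Q odd_l R ιX K' constEmb constEmb_injective hinvc hinvp := rfl

end Nested

end ThetaFrobenioid

end Literature.AnabelianGeometry.EtaleTheta

end
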